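import Literature.AnabelianGeometry.SemiGraphs.TemperedCompactPairFiniteCore
import HarnessLib

/-!
# Two compact subgroups of `π₁^temp(𝒢)` at a graph WITHOUT ω-CORE (every non-empty set of vertices has a member joined
# to the set by only finitely many closed edges): jointly compact or ANCHORED — the residual of [SemiAnbd] Thm 3.7 (iv),
# sentence 2, in the cell's ∀-countable typing lives over a SELF-SUSTAINING set of infinite-valence base vertices

Mochizuki, *Semi-graphs of anabelioids*, Publ. RIMS **42** (2006), §3, Theorem 3.7 (iv) p. 41: "The maximal
compact subgroups of `π₁^temp(𝒢)` are precisely the verticial subgroups. The nontrivial intersections of two distinct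
maximal compact subgroups of `π₁^temp(𝒢)` are precisely the edge-like subgroups." [cite: MochizukiSemiAnbd2006, Thm 3.7(iv) p.41].

PROOF-ONLY tool file (abc-iut cell, layer L3, row «T37iv-S2@FINITE-CORE-CLASS», file F12, seat abc-iut-L3-t8 gen 12;
no definition, no named fact).  Canonical chart of ANY countable `𝒢` with the hypotheses of Thm 3.7.  An *ω-core* of
the base graph `𝔾` is a non-empty set `W` of vertices every member of which carries INFINITELY many branches whose
edge has its other branch at a member of `W`; say `𝔾` has *no ω-core* (a hypothesis binder below, not a definition)
if every non-empty set of vertices has a member with only finitely many branches into the set.  This class contains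
the locally-finite-core class of F11 (`noOmegaCore_of_finiteCore`), hence the sparse and the locally finite graphs,
and e.g. every star of stars (a centre joined to infinitely many centres of infinite stars); outside it lie two
vertices joined by infinitely many edges, a vertex with infinitely many loops, ….

* ★★★ `isCompact_or_anchored_of_noOmegaCore` — at a Thm-3.7 graph without ω-core two compact subgroups `K₁`, `K₂`
  with `K₁ ⊓ K₂ ≠ 1` generate a compact subgroup or are ANCHORED.  Proof (F11's engine run at a VARIABLE base
  vertex): past a bridge-free level `M₀` without common fixed vertex (F1/F2), let `U` be the set of base vertices
  under the INTERIOR vertices of the extremal paths between the fixed loci of all levels `M ≥ M₀` (non-empty by F8's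
  first step).  `U` is SELF-SUSTAINING: for `u ∈ U` under the interior vertex `z` of an extremal path of level `M`,
  the branches of `𝒢_{∞,M}` at `z` over a branch of `u` INTO `U`, or along an edge towards a `K₁`- or `K₂`-fixed
  vertex, would — if the former were finitely many — form a finite set `F` containing BOTH images of the unfolded
  `K₁ ⊓ K₂`-fixed pair over `z` on the extremal path of every level `M' ≥ M` (F8 `exists_unfolded_crossing_of_mem_path`;
  the opposite branch of a member ends at a fixed end, or at an interior vertex, which lies over `U` by the very
  definition of `U`), contradicting F7 `false_of_forall_unfolded_mem_finite`.  So `U` is an ω-core;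
* ★★ the three ∀-pieces of (iv) OUTRIGHT for the class (`…_of_noOmegaCore`: ANCHORED PACKAGE, ISOLATION, SENTENCE
  2), `noOmegaCore_of_finiteCore` (F11's binder implies this one) and `noOmegaCore_of_coreSparse` (of the two
  vertices of any closed edge one has finite core-valence — stars of stars, …).

So in the cell's ∀-countable typing any failure of sentence 2 of Thm 3.7 (iv) needs an ω-core of the base graph: a
non-empty set of vertices (all of infinite valence) each joined to the set by infinitely many closed edges (and, by
the group-theoretic companion F14 `TemperedCompactPairNullEdgeGroups.lean`, a vertex group with an open subgroup
missing infinitely many of the edge groups at that vertex).  Honest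
framing: statements about OUR typed `π₁^temp` at OUR typed carriers; print's Thm 3.7 concerns the graphs of
[SemiAnbd] (the IUT chain's dual graphs are finite); nothing here bears on [IUTchIII] Cor. 3.12; no side taken;
typed ≠ proved.
-/
noncomputable section

open CategoryTheory Topology

namespace Literature.AnabelianGeometry.SemiGraphs

open SimpleGraph

universe u

namespace ProfiniteSemiGraph

variable {𝒢 : ProfiniteSemiGraph.{u}}

/-! ### ★★★ No ω-core: jointly compact or anchored -/

section NoOmegaCore

variable (h37 : 𝒢.Thm37Hypotheses)

/-- ★★★ **At a Thm-3.7 graph WITHOUT ω-CORE, two compact subgroups of `π₁^temp(𝒢)` meeting non-trivially generate a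
compact subgroup or are ANCHORED** (`K₁`, `K₂` in verticial subgroups, `K₁ ⊓ K₂` in an edge-like subgroup).  No
ω-core: every non-empty set `W` of base vertices has a member with only finitely many branches whose edge has its other
branch at a member of `W`.  The set `U` of base vertices under the interior vertices of the extremal paths between the
fixed loci (levels `≥ M₀`, `M₀` bridge-free without common fixed vertex) would otherwise be an ω-core: F11's finite
set `F` at an interior vertex `z` over the offending member, F8's unfolded pairs over `z`, F7 — see the file header.
[cite: MochizukiSemiAnbd2006, Thm 3.7(iv) p.41] -/
theorem isCompact_or_anchored_of_noOmegaCore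
    (hω : ∀ W : Set 𝒢.graph.Vertex, W.Nonempty → ∃ w ∈ W, {b | 𝒢.graph.abuts b = some w ∧ ∃ b', b' ≠ b ∧
      𝒢.graph.edgeOf b' = 𝒢.graph.edgeOf b ∧ ∃ w' ∈ W, 𝒢.graph.abuts b' = some w'}.Finite)
    (K₁ K₂ : Subgroup ((𝒢.galoisLevelData h37.toProp36Hypotheses).temperedPi h37.toProp36Hypotheses.isCountable))
    (hK₁ : IsCompact (K₁ : Set ((𝒢.galoisLevelData h37.toProp36Hypotheses).temperedPi h37.toProp36Hypotheses.isCountable)))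
    (hK₂ : IsCompact (K₂ : Set ((𝒢.galoisLevelData h37.toProp36Hypotheses).temperedPi h37.toProp36Hypotheses.isCountable))) (hne : K₁ ⊓ K₂ ≠ ⊥) :
    IsCompact ((K₁ ⊔ K₂).topologicalClosure : Set ((𝒢.galoisLevelData h37.toProp36Hypotheses).temperedPi h37.toProp36Hypotheses.isCountable)) ∨
    ((∃ (v : 𝒢.graph.Vertex) (H : Subgroup (𝒢.temperedPiChart h37.toProp36Hypotheses).G),
        H ∈ verticialSubgroups (𝒢.temperedPiChart h37.toProp36Hypotheses) v ∧ K₁ ≤ H) ∧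
      (∃ (v : 𝒢.graph.Vertex) (H : Subgroup (𝒢.temperedPiChart h37.toProp36Hypotheses).G),
        H ∈ verticialSubgroups (𝒢.temperedPiChart h37.toProp36Hypotheses) v ∧ K₂ ≤ H) ∧
      ∃ (e : 𝒢.graph.Edge) (L : Subgroup (𝒢.temperedPiChart h37.toProp36Hypotheses).G),
        L ∈ edgeLikeSubgroups (𝒢.temperedPiChart h37.toProp36Hypotheses) e ∧ K₁ ⊓ K₂ ≤ L) := by
  classical
  have h36 := h37.toProp36Hypotheses
  let Dg := 𝒢.galoisLevelData h36
  have hc := h36.isCountable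
  let D₀ : VerticialLevelData.{0} 𝒢 (𝒢.temperedPiChart h36) := verticialLevelData_temperedPiChart (h36 := h36)
  by_cases hK : IsCompact (((K₁ ⊔ K₂).topologicalClosure : Subgroup (Dg.temperedPi hc)) : Set (Dg.temperedPi hc))
  · exact Or.inl hK
  right
  -- some level `m` without a common fixed vertex (F1)
  obtain ⟨m, hm⟩ : ∃ m : ℕ, ∀ z : (Dg.tree m).Vertex,
      (∀ k ∈ K₁, (Dg.treeAct hc m k).hom.vertexMap z = z) → ¬ ∀ k ∈ K₂, (Dg.treeAct hc m k).hom.vertexMap z = z := by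
    by_contra h
    push Not at h
    exact hK (isCompact_topologicalClosure_sup_of_forall_exists_common_fixed_vertex h36 K₁ K₂
      fun m => by obtain ⟨z, hz₁, hz₂⟩ := h m; exact ⟨z, hz₁, hz₂⟩)
  by_cases hbr : ∀ M : ℕ, m ≤ M → ∃ (x y : (Dg.tree M).Vertex) (β₁ β₂ : (Dg.tree M).Branch), β₁ ≠ β₂ ∧
      (Dg.tree M).edgeOf β₁ = (Dg.tree M).edgeOf β₂ ∧ (Dg.tree M).abuts β₁ = some x ∧ (Dg.tree M).abuts β₂ = some y ∧
      (∀ k ∈ K₁, (Dg.treeAct hc M k).hom.vertexMap x = x) ∧ ∀ k ∈ K₂, (Dg.treeAct hc M k).hom.vertexMap y = y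
  · -- bridges at every level `M ≥ m`: the anchored regime (F2)
    obtain ⟨h₁, h₂⟩ := exists_verticial_ge_of_forall_exists_bridge h36 K₁ K₂ m hm hbr
    exact ⟨h₁, h₂, exists_edgeLike_ge_inf_of_forall_exists_bridge h36 K₁ K₂ m hm hbr⟩
  push Not at hbr
  obtain ⟨M₀, hmM₀, hnobr₀⟩ := hbr
  -- fixed loci, pushed-down fixedness, compactness of `K₁ ⊓ K₂`
  let A : ∀ M : ℕ, Set (Dg.tree M).Vertex := fun M => {a | ∀ k ∈ K₁, (Dg.treeAct hc M k).hom.vertexMap a = a}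
  let B : ∀ M : ℕ, Set (Dg.tree M).Vertex := fun M => {b | ∀ k ∈ K₂, (Dg.treeAct hc M k).hom.vertexMap b = b}
  have hno : ∀ {M : ℕ}, M₀ ≤ M → ∀ z : (Dg.tree M).Vertex, z ∈ A M → z ∉ B M :=
    fun hM z hz => forall_not_common_fixed_of_le h36 K₁ K₂ (hmM₀.trans hM) hm z hz
  have hpushV : ∀ (K : Subgroup (Dg.temperedPi hc)) {M M' : ℕ} (h : M ≤ M') (w : (Dg.tree M').Vertex),
      (∀ k ∈ K, (Dg.treeAct hc M' k).hom.vertexMap w = w) →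
      ∀ k ∈ K, (Dg.treeAct hc M k).hom.vertexMap ((Dg.treeTrans h).vertexMap w) = (Dg.treeTrans h).vertexMap w := by
    intro K M M' h w hw k hk
    have e : (Dg.treeTrans h).vertexMap ((Dg.treeAct hc M' k).hom.vertexMap w) =
        (Dg.treeAct hc M k).hom.vertexMap ((Dg.treeTrans h).vertexMap w) := D₀.trans_act_vertexMap h k w
    rw [hw k hk] at e
    exact e.symm
  haveI : T2Space (Dg.temperedPi hc) := Dg.t2Space_temperedPi hc
  have hCc : IsCompact ((K₁ ⊓ K₂ : Subgroup _) : Set (Dg.temperedPi hc)) := by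
    rw [Subgroup.coe_inf]; exact hK₁.inter_right hK₂.isClosed
  have hoverB : ∀ {M M' : ℕ} (hM : M ≤ M') (b : (Dg.tree M').Branch),
      (Dg.treeProj M).branchMap ((Dg.treeTrans hM).branchMap b) = (Dg.treeProj M').branchMap b := fun hM b => by
    simpa only [SemiGraph.comp_branchMap, Function.comp_apply] using
      congrArg (fun φ => SemiGraph.Hom.branchMap φ b) (Dg.treeTrans_over hM)
  have hoverV : ∀ {M M' : ℕ} (hM : M ≤ M') (w : (Dg.tree M').Vertex),
      (Dg.treeProj M).vertexMap ((Dg.treeTrans hM).vertexMap w) = (Dg.treeProj M').vertexMap w := fun hM w => by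
    simpa only [SemiGraph.comp_vertexMap, Function.comp_apply] using
      congrArg (fun φ => SemiGraph.Hom.vertexMap φ w) (Dg.treeTrans_over hM)
  -- an extremal path between the fixed loci at every level (F8)
  have hext : ∀ M : ℕ, ∃ (x y : (Dg.tree M).Vertex) (δ : (Dg.tree M).subdivision.Walk (Sum.inl x) (Sum.inl y)),
      x ∈ A M ∧ y ∈ B M ∧ δ.IsPath ∧ ∀ v : (Dg.tree M).Vertex, (Sum.inl v : (Dg.tree M).Node) ∈ δ.support →
        (v ∈ A M → v = x) ∧ (v ∈ B M → v = y) := by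
    intro M
    obtain ⟨a₀, ha₀⟩ := D₀.exists_forall_mem_fixed_vertex_of_isCompact K₁ hK₁ M
    obtain ⟨b₀, hb₀⟩ := D₀.exists_forall_mem_fixed_vertex_of_isCompact K₂ hK₂ M
    obtain ⟨γ₀, hγ₀, -⟩ := ((Dg.isTree_tree M).isTree.connected (Sum.inl a₀ : (Dg.tree M).Node) (Sum.inl b₀)).exists_path_of_dist
    obtain ⟨x, y, δ, hx, hy, hδ, -, hext⟩ := SemiGraph.exists_extremal_subpath (A M) (B M) γ₀.length γ₀ hγ₀ rfl ha₀ hb₀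
    exact ⟨x, y, δ, hx, hy, hδ, hext⟩
  -- the base vertices under the interior vertices of the extremal paths of the levels `M ≥ M₀`
  let U : Set 𝒢.graph.Vertex := {v | ∃ (M : ℕ) (_ : M₀ ≤ M) (x y : (Dg.tree M).Vertex)
    (δ : (Dg.tree M).subdivision.Walk (Sum.inl x) (Sum.inl y)) (t : (Dg.tree M).Vertex),
    x ∈ A M ∧ y ∈ B M ∧ δ.IsPath ∧ (Sum.inl t : (Dg.tree M).Node) ∈ δ.support ∧ t ∉ A M ∧ t ∉ B M ∧
    (Dg.treeProj M).vertexMap t = v}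
  -- `U` is non-empty: the first interior vertex of the extremal path of the bridge-free level `M₀`
  have hU : U.Nonempty := by
    obtain ⟨x, y, δ, hxA, hyB, hδ, hext₀⟩ := hext M₀
    have hxy : x ≠ y := fun h => hno le_rfl x hxA (h ▸ hyB)
    obtain ⟨β₁, β₁', z, δ₁, h11, he₁, hβ₁x, hβ₁'z, -, hsupp₁⟩ := SemiGraph.exists_first_step δ rfl rfl hδ hxy
    have hzδ : (Sum.inl z : (Dg.tree M₀).Node) ∈ δ.support := by
      rw [hsupp₁]; exact List.mem_append_right _ δ₁.start_mem_support
    have hxδ₁ : (Sum.inl x : (Dg.tree M₀).Node) ∉ δ₁.support := by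
      have hnd : δ.support.Nodup := (Walk.isPath_def δ).mp hδ
      rw [hsupp₁] at hnd
      exact fun h => (List.disjoint_of_nodup_append hnd) (by simp) h
    have hzx : z ≠ x := fun h => hxδ₁ (h ▸ δ₁.start_mem_support)
    have hzA : z ∉ A M₀ := fun h => hzx ((hext₀ z hzδ).1 h)
    have hzy : z ≠ y := by
      intro h; subst h
      exact hnobr₀ x z β₁ β₁' h11 he₁ hβ₁x hβ₁'z hxA |>.elim fun k hk => hk.2 (hyB k hk.1)
    have hzB : z ∉ B M₀ := fun h => hzy ((hext₀ z hzδ).2 h)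
    exact ⟨_, M₀, le_rfl, x, y, δ, z, hxA, hyB, hδ, hzδ, hzA, hzB, rfl⟩
  -- a member of `U` with finitely many branches into `U`, and its witnesses
  obtain ⟨u₀, hu₀U, hfin⟩ := hω U hU
  obtain ⟨M, hM₀M, x, y, δ, z, hxA, hyB, hδ, hzδ, hzA, hzB, hzu₀⟩ := hu₀U
  let T := Dg.tree M
  -- the finite set `F` of branches at `z`: over a branch of `u₀` into `U`, or along an edge towards a fixed vertex
  let Core : Set 𝒢.graph.Branch := {b | 𝒢.graph.abuts b = some u₀ ∧ ∃ b', b' ≠ b ∧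
    𝒢.graph.edgeOf b' = 𝒢.graph.edgeOf b ∧ ∃ w' ∈ U, 𝒢.graph.abuts b' = some w'}
  have hCore : Core.Finite := hfin
  let FA : Set T.Branch := {γ | T.abuts γ = some z ∧ ∃ (γ' : T.Branch) (x' : T.Vertex), γ' ≠ γ ∧
    T.edgeOf γ' = T.edgeOf γ ∧ T.abuts γ' = some x' ∧ x' ∈ A M}
  let FB : Set T.Branch := {γ | T.abuts γ = some z ∧ ∃ (γ' : T.Branch) (y' : T.Vertex), γ' ≠ γ ∧
    T.edgeOf γ' = T.edgeOf γ ∧ T.abuts γ' = some y' ∧ y' ∈ B M}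
  let FC : Set T.Branch := {γ | T.abuts γ = some z ∧ (Dg.treeProj M).branchMap γ ∈ Core}
  have hFA : FA.Finite := by
    refine Set.Subsingleton.finite ?_
    rintro γ₁ ⟨hγ₁, γ₁', x₁, hne₁, he₁', hx₁, hx₁A⟩ γ₂ ⟨hγ₂, γ₂', x₂, hne₂, he₂', hx₂, hx₂A⟩
    exact (fixed_neighbour_unique h36 M K₁ hne₁ he₁' hx₁ hγ₁ hne₂ he₂' hx₂ hγ₂ hx₁A hx₂A hzA).2.2
  have hFB : FB.Finite := by
    refine Set.Subsingleton.finite ?_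
    rintro γ₁ ⟨hγ₁, γ₁', y₁, hne₁, he₁', hy₁, hy₁B⟩ γ₂ ⟨hγ₂, γ₂', y₂, hne₂, he₂', hy₂, hy₂B⟩
    exact (fixed_neighbour_unique h36 M K₂ hne₁ he₁' hy₁ hγ₁ hne₂ he₂' hy₂ hγ₂ hy₁B hy₂B hzB).2.2
  have hFC : FC.Finite := finite_branches_at_over_finite h36 M z Core hCore
  let F : Set T.Branch := FC ∪ (FA ∪ FB)
  have hF : F.Finite := hFC.union (hFA.union hFB)
  -- every level `M' ≥ M` carries an unfolded `K₁ ⊓ K₂`-fixed pair over `z` with both images in `F`: impossible (F7)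
  refine (false_of_forall_unfolded_mem_finite h37 (K₁ ⊓ K₂) hCc hne M z F hF fun M' hM => ?_).elim
  let TM := Dg.tree M'
  obtain ⟨xM, yM, γ, hxM, hyM, hγ, hextM⟩ := hext M'
  obtain ⟨w, β, β', hw, hβ, hβ', hβw, hβ'w, hwz, hββ'⟩ :=
    exists_unfolded_crossing_of_mem_path h36 K₁ K₂ M hxA hyB δ hδ z hzδ hzA hzB M' hM hxM hyM γ
  let π := Dg.treeTrans hM
  -- the image of a branch of `γ` at `w` lies in `F`
  have hmemF : ∀ b : TM.Branch, (Sum.inr (Sum.inr b) : TM.Node) ∈ γ.support → TM.abuts b = some w →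
      π.branchMap b ∈ F := by
    intro b hb hbw
    have hπb : T.abuts (π.branchMap b) = some z := by rw [π.abuts_branchMap b w hbw, hwz]
    obtain ⟨b'', t'', hb''b, hb''e, hb''t, hb''γ, ht''γ⟩ := SemiGraph.exists_opposite_branch_on_path γ hγ hb
    have hπne : π.branchMap b'' ≠ π.branchMap b := fun h => hb''b (π.branchMap_injOn _ _ hb''e h)
    have hπe : T.edgeOf (π.branchMap b'') = T.edgeOf (π.branchMap b) := by
      rw [π.edgeOf_branchMap, π.edgeOf_branchMap, hb''e]
    have hπt : T.abuts (π.branchMap b'') = some (π.vertexMap t'') := π.abuts_branchMap b'' t'' hb''t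
    by_cases htx : t'' = xM
    · refine Or.inr (Or.inl ⟨hπb, π.branchMap b'', π.vertexMap t'', hπne, hπe, hπt, ?_⟩)
      rw [htx]
      exact hpushV K₁ hM xM hxM
    by_cases hty : t'' = yM
    · refine Or.inr (Or.inr ⟨hπb, π.branchMap b'', π.vertexMap t'', hπne, hπe, hπt, ?_⟩)
      rw [hty]
      exact hpushV K₂ hM yM hyM
    -- the opposite branch ends at an interior vertex of `γ`, whose base vertex lies in `U` by definition
    have htA : t'' ∉ A M' := fun h => htx ((hextM t'' ht''γ).1 h)
    have htB : t'' ∉ B M' := fun h => hty ((hextM t'' ht''γ).2 h)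
    have htU : (Dg.treeProj M').vertexMap t'' ∈ U :=
      ⟨M', hM₀M.trans hM, xM, yM, γ, t'', hxM, hyM, hγ, ht''γ, htA, htB, rfl⟩
    refine Or.inl ⟨hπb, ?_⟩
    rw [hoverB hM b]
    have hbu : 𝒢.graph.abuts ((Dg.treeProj M').branchMap b) = some u₀ := by
      rw [(Dg.treeProj M').abuts_branchMap b w hbw, ← hoverV hM w, hwz, hzu₀]
    refine ⟨hbu, (Dg.treeProj M').branchMap b'', fun h => hb''b ((Dg.treeProj M').branchMap_injOn _ _ hb''e h), ?_,
      (Dg.treeProj M').vertexMap t'', htU, (Dg.treeProj M').abuts_branchMap b'' t'' hb''t⟩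
    rw [(Dg.treeProj M').edgeOf_branchMap, (Dg.treeProj M').edgeOf_branchMap, hb''e]
  refine ⟨w, β, β', hβw, hβ'w, hwz, hββ', hmemF β hβ hβw, hmemF β' hβ' hβ'w, fun g hg => ?_⟩
  obtain ⟨hg₁, hg₂⟩ := Subgroup.mem_inf.mp hg
  obtain ⟨hfixV, hfixB⟩ := fixes_of_mem_support_path h36 M' g (hxM g hg₁) (hyM g hg₂) γ hγ
  exact ⟨hfixV w hw, hfixB β hβ, hfixB β' hβ'⟩

/-- ★★ **THE ω-CORE RESIDUAL.**  If two compact subgroups of `π₁^temp(𝒢)` meeting non-trivially neither generate a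
compact subgroup nor are anchored, the base graph has an ω-CORE: a non-empty set of vertices each carrying infinitely
many branches whose edge has its other branch inside the set (contrapositive handle of
`isCompact_or_anchored_of_noOmegaCore` for the successor rows). [cite: MochizukiSemiAnbd2006, Thm 3.7(iv) p.41] -/
theorem exists_omegaCore_of_not_isCompact_of_not_anchored
    (K₁ K₂ : Subgroup ((𝒢.galoisLevelData h37.toProp36Hypotheses).temperedPi h37.toProp36Hypotheses.isCountable))
    (hK₁ : IsCompact (K₁ : Set ((𝒢.galoisLevelData h37.toProp36Hypotheses).temperedPi h37.toProp36Hypotheses.isCountable)))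
    (hK₂ : IsCompact (K₂ : Set ((𝒢.galoisLevelData h37.toProp36Hypotheses).temperedPi h37.toProp36Hypotheses.isCountable))) (hne : K₁ ⊓ K₂ ≠ ⊥)
    (hK : ¬ IsCompact ((K₁ ⊔ K₂).topologicalClosure : Set ((𝒢.galoisLevelData h37.toProp36Hypotheses).temperedPi h37.toProp36Hypotheses.isCountable)))
    (hna : ¬ ((∃ (v : 𝒢.graph.Vertex) (H : Subgroup (𝒢.temperedPiChart h37.toProp36Hypotheses).G),
        H ∈ verticialSubgroups (𝒢.temperedPiChart h37.toProp36Hypotheses) v ∧ K₁ ≤ H) ∧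
      (∃ (v : 𝒢.graph.Vertex) (H : Subgroup (𝒢.temperedPiChart h37.toProp36Hypotheses).G),
        H ∈ verticialSubgroups (𝒢.temperedPiChart h37.toProp36Hypotheses) v ∧ K₂ ≤ H) ∧
      ∃ (e : 𝒢.graph.Edge) (L : Subgroup (𝒢.temperedPiChart h37.toProp36Hypotheses).G),
        L ∈ edgeLikeSubgroups (𝒢.temperedPiChart h37.toProp36Hypotheses) e ∧ K₁ ⊓ K₂ ≤ L)) :
    ∃ W : Set 𝒢.graph.Vertex, W.Nonempty ∧ ∀ w ∈ W, ¬ {b | 𝒢.graph.abuts b = some w ∧ ∃ b', b' ≠ b ∧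
      𝒢.graph.edgeOf b' = 𝒢.graph.edgeOf b ∧ ∃ w' ∈ W, 𝒢.graph.abuts b' = some w'}.Finite := by
  by_contra h
  push Not at h
  rcases isCompact_or_anchored_of_noOmegaCore h37 h K₁ K₂ hK₁ hK₂ hne with hc | ha
  · exact hK hc
  · exact hna ha

/-! ### ★★ The three ∀-pieces of Thm 3.7 (iv) OUTRIGHT at graphs without ω-core -/

/-- ★★ **ANCHORED PACKAGE at a graph without ω-core**: a compact subgroup `K` of `π₁^temp(𝒢)` meeting a VERTICIAL
subgroup `H` non-trivially lies in SOME verticial subgroup. [cite: MochizukiSemiAnbd2006, Thm 3.7(iv) p.41] -/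
theorem exists_verticial_ge_of_inf_verticial_ne_bot_of_noOmegaCore {v : 𝒢.graph.Vertex}
    (hω : ∀ W : Set 𝒢.graph.Vertex, W.Nonempty → ∃ w ∈ W, {b | 𝒢.graph.abuts b = some w ∧ ∃ b', b' ≠ b ∧
      𝒢.graph.edgeOf b' = 𝒢.graph.edgeOf b ∧ ∃ w' ∈ W, 𝒢.graph.abuts b' = some w'}.Finite)
    (H K : Subgroup ((𝒢.galoisLevelData h37.toProp36Hypotheses).temperedPi h37.toProp36Hypotheses.isCountable))
    (hH : H ∈ verticialSubgroups (𝒢.temperedPiChart h37.toProp36Hypotheses) v)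
    (hK : IsCompact (K : Set ((𝒢.galoisLevelData h37.toProp36Hypotheses).temperedPi h37.toProp36Hypotheses.isCountable))) (hne : H ⊓ K ≠ ⊥) :
    ∃ (w : 𝒢.graph.Vertex) (H' : Subgroup (𝒢.temperedPiChart h37.toProp36Hypotheses).G),
      H' ∈ verticialSubgroups (𝒢.temperedPiChart h37.toProp36Hypotheses) w ∧ K ≤ H' := by
  have h36 := h37.toProp36Hypotheses
  have hHc : IsCompact (H : Set ((𝒢.galoisLevelData h36).temperedPi h36.isCountable)) :=
    isCompact_of_mem_verticialSubgroups (𝒢.temperedPiChart h36) hH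
  rcases isCompact_or_anchored_of_noOmegaCore h37 hω H K hHc hK hne with hcpt | ⟨-, hK', -⟩
  · have hle : H ≤ (H ⊔ K).topologicalClosure := le_sup_left.trans (Subgroup.le_topologicalClosure _)
    have heq := eq_of_verticial_le_compact h37 (𝒢.temperedPiChart h36) hH hcpt hle
    exact ⟨v, H, hH, (le_sup_right.trans (Subgroup.le_topologicalClosure _)).trans heq.le⟩
  · exact hK'

/-- ★★ **ISOLATION at a graph without ω-core**: a compact subgroup `K` meeting an EXOTIC maximal compact subgroup `K₀`
(one lying in no verticial subgroup) non-trivially lies in `K₀`. [cite: MochizukiSemiAnbd2006, Thm 3.7(iv) p.41] -/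
theorem le_of_isMaximalCompactSubgroup_of_exotic_of_noOmegaCore
    (hω : ∀ W : Set 𝒢.graph.Vertex, W.Nonempty → ∃ w ∈ W, {b | 𝒢.graph.abuts b = some w ∧ ∃ b', b' ≠ b ∧
      𝒢.graph.edgeOf b' = 𝒢.graph.edgeOf b ∧ ∃ w' ∈ W, 𝒢.graph.abuts b' = some w'}.Finite)
    (K K₀ : Subgroup ((𝒢.galoisLevelData h37.toProp36Hypotheses).temperedPi h37.toProp36Hypotheses.isCountable))
    (hK : IsCompact (K : Set ((𝒢.galoisLevelData h37.toProp36Hypotheses).temperedPi h37.toProp36Hypotheses.isCountable))) (hK₀ : IsMaximalCompactSubgroup K₀)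
    (hK₀ex : ∀ (w : 𝒢.graph.Vertex) (H' : Subgroup (𝒢.temperedPiChart h37.toProp36Hypotheses).G),
      H' ∈ verticialSubgroups (𝒢.temperedPiChart h37.toProp36Hypotheses) w → ¬ K₀ ≤ H')
    (hne : K ⊓ K₀ ≠ ⊥) : K ≤ K₀ := by
  rcases isCompact_or_anchored_of_noOmegaCore h37 hω K K₀ hK hK₀.1 hne with hcpt | ⟨-, ⟨w, H', hH', hK₀H'⟩, -⟩
  · have hle₀ : K₀ ≤ (K ⊔ K₀).topologicalClosure := le_sup_right.trans (Subgroup.le_topologicalClosure _)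
    have heq := hK₀.2 _ hcpt hle₀
    exact (le_sup_left.trans (Subgroup.le_topologicalClosure _)).trans heq.le
  · exact absurd hK₀H' (hK₀ex w H' hH')

/-- ★★ **An exotic maximal compact subgroup of a graph without ω-core meets every OTHER maximal compact subgroup
trivially.** [cite: MochizukiSemiAnbd2006, Thm 3.7(iv) p.41] -/
theorem inf_eq_bot_of_isMaximalCompactSubgroup_of_exotic_of_ne_of_noOmegaCore
    (hω : ∀ W : Set 𝒢.graph.Vertex, W.Nonempty → ∃ w ∈ W, {b | 𝒢.graph.abuts b = some w ∧ ∃ b', b' ≠ b ∧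
      𝒢.graph.edgeOf b' = 𝒢.graph.edgeOf b ∧ ∃ w' ∈ W, 𝒢.graph.abuts b' = some w'}.Finite)
    (K K₀ : Subgroup ((𝒢.galoisLevelData h37.toProp36Hypotheses).temperedPi h37.toProp36Hypotheses.isCountable))
    (hK : IsMaximalCompactSubgroup K) (hK₀ : IsMaximalCompactSubgroup K₀)
    (hK₀ex : ∀ (w : 𝒢.graph.Vertex) (H' : Subgroup (𝒢.temperedPiChart h37.toProp36Hypotheses).G),
      H' ∈ verticialSubgroups (𝒢.temperedPiChart h37.toProp36Hypotheses) w → ¬ K₀ ≤ H')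
    (hKK₀ : K ≠ K₀) : K ⊓ K₀ = ⊥ := by
  by_contra hne
  have hle : K ≤ K₀ :=
    le_of_isMaximalCompactSubgroup_of_exotic_of_noOmegaCore h37 hω K K₀ hK.1 hK₀ hK₀ex hne
  exact hKK₀ (hK.2 K₀ hK₀.1 hle).symm

/-- ★★ **THM 3.7 (iv), SECOND SENTENCE, at a graph without ω-core**: two DISTINCT maximal compact subgroups of
`π₁^temp(𝒢)` meeting non-trivially are BOTH VERTICIAL and their intersection lies in an EDGE-LIKE subgroup.
[cite: MochizukiSemiAnbd2006, Thm 3.7(iv) p.41] -/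
theorem verticial_of_isMaximalCompactSubgroup_of_ne_of_noOmegaCore
    (hω : ∀ W : Set 𝒢.graph.Vertex, W.Nonempty → ∃ w ∈ W, {b | 𝒢.graph.abuts b = some w ∧ ∃ b', b' ≠ b ∧
      𝒢.graph.edgeOf b' = 𝒢.graph.edgeOf b ∧ ∃ w' ∈ W, 𝒢.graph.abuts b' = some w'}.Finite)
    (K₁ K₂ : Subgroup ((𝒢.galoisLevelData h37.toProp36Hypotheses).temperedPi h37.toProp36Hypotheses.isCountable))
    (hK₁ : IsMaximalCompactSubgroup K₁) (hK₂ : IsMaximalCompactSubgroup K₂) (hne₁₂ : K₁ ≠ K₂)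
    (hne : K₁ ⊓ K₂ ≠ ⊥) :
    (∃ v : 𝒢.graph.Vertex, K₁ ∈ verticialSubgroups (𝒢.temperedPiChart h37.toProp36Hypotheses) v) ∧
      (∃ v : 𝒢.graph.Vertex, K₂ ∈ verticialSubgroups (𝒢.temperedPiChart h37.toProp36Hypotheses) v) ∧
      ∃ (e : 𝒢.graph.Edge) (L : Subgroup (𝒢.temperedPiChart h37.toProp36Hypotheses).G),
        L ∈ edgeLikeSubgroups (𝒢.temperedPiChart h37.toProp36Hypotheses) e ∧ K₁ ⊓ K₂ ≤ L := by
  rcases isCompact_or_anchored_of_noOmegaCore h37 hω K₁ K₂ hK₁.1 hK₂.1 hne with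
    hcpt | ⟨⟨v₁, H₁, hH₁, hK₁H₁⟩, ⟨v₂, H₂, hH₂, hK₂H₂⟩, hedge⟩
  · have h₁ := hK₁.2 _ hcpt (le_sup_left.trans (Subgroup.le_topologicalClosure _))
    have h₂ := hK₂.2 _ hcpt (le_sup_right.trans (Subgroup.le_topologicalClosure _))
    exact absurd (h₁.symm.trans h₂) hne₁₂
  · have h₁ : K₁ = H₁ := le_antisymm hK₁H₁ ((hK₁.2 H₁ (isCompact_of_mem_verticialSubgroups _ hH₁) hK₁H₁).le)
    have h₂ : K₂ = H₂ := le_antisymm hK₂H₂ ((hK₂.2 H₂ (isCompact_of_mem_verticialSubgroups _ hH₂) hK₂H₂).le)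
    exact ⟨⟨v₁, h₁ ▸ hH₁⟩, ⟨v₂, h₂ ▸ hH₂⟩, hedge⟩

end NoOmegaCore

/-- **Locally finite core ⇒ no ω-core** (F11's binder implies F12's): in a non-empty set `W` of vertices pick a
member of finite valence if there is one; otherwise every member has infinite valence and the branches of any member
into `W` are core branches, finitely many. [cite: MochizukiSemiAnbd2006, Thm 3.7(iv) p.41] -/
theorem noOmegaCore_of_finiteCore
    (hcore : ∀ v, ¬ {c | 𝒢.graph.abuts c = some v}.Finite → {b | 𝒢.graph.abuts b = some v ∧ ∃ b', b' ≠ b ∧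
      𝒢.graph.edgeOf b' = 𝒢.graph.edgeOf b ∧ ∃ v', 𝒢.graph.abuts b' = some v' ∧ ¬ {c | 𝒢.graph.abuts c = some v'}.Finite}.Finite) :
    ∀ W : Set 𝒢.graph.Vertex, W.Nonempty → ∃ w ∈ W, {b | 𝒢.graph.abuts b = some w ∧ ∃ b', b' ≠ b ∧
      𝒢.graph.edgeOf b' = 𝒢.graph.edgeOf b ∧ ∃ w' ∈ W, 𝒢.graph.abuts b' = some w'}.Finite := by
  intro W hW
  by_cases hfin : ∃ w ∈ W, {c | 𝒢.graph.abuts c = some w}.Finite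
  · obtain ⟨w, hwW, hw⟩ := hfin
    exact ⟨w, hwW, hw.subset fun b hb => hb.1⟩
  · push Not at hfin
    obtain ⟨w, hwW⟩ := hW
    refine ⟨w, hwW, (hcore w (hfin w hwW)).subset ?_⟩
    rintro b ⟨hb, b', hb'b, he, w', hw'W, hb'⟩
    exact ⟨hb, b', hb'b, he, w', hb', hfin w' hw'W⟩

/-- **Core-sparse graphs have no ω-core**: if of the two vertices of any closed edge at least one carries only finitely
many *core* branches (branches whose edge has its other branch at a vertex of infinite valence) — e.g. a star of
stars, whose only vertex of infinite core-valence is the centre — then every non-empty set of vertices has a member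
with finitely many branches into the set (in an ω-core every member has infinite core-valence, and two of them are
joined by an edge). [cite: MochizukiSemiAnbd2006, Thm 3.7(iv) p.41] -/
theorem noOmegaCore_of_coreSparse
    (hcs : ∀ (b b' : 𝒢.graph.Branch) (v v' : 𝒢.graph.Vertex), b ≠ b' → 𝒢.graph.edgeOf b = 𝒢.graph.edgeOf b' →
      𝒢.graph.abuts b = some v → 𝒢.graph.abuts b' = some v' →
      {c | 𝒢.graph.abuts c = some v ∧ ∃ c', c' ≠ c ∧ 𝒢.graph.edgeOf c' = 𝒢.graph.edgeOf c ∧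
        ∃ u, 𝒢.graph.abuts c' = some u ∧ ¬ {d | 𝒢.graph.abuts d = some u}.Finite}.Finite ∨
      {c | 𝒢.graph.abuts c = some v' ∧ ∃ c', c' ≠ c ∧ 𝒢.graph.edgeOf c' = 𝒢.graph.edgeOf c ∧
        ∃ u, 𝒢.graph.abuts c' = some u ∧ ¬ {d | 𝒢.graph.abuts d = some u}.Finite}.Finite) :
    ∀ W : Set 𝒢.graph.Vertex, W.Nonempty → ∃ w ∈ W, {b | 𝒢.graph.abuts b = some w ∧ ∃ b', b' ≠ b ∧
      𝒢.graph.edgeOf b' = 𝒢.graph.edgeOf b ∧ ∃ w' ∈ W, 𝒢.graph.abuts b' = some w'}.Finite := by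
  intro W hW
  by_contra h
  push Not at h
  -- every member of `W` has infinite valence
  have hinf : ∀ u ∈ W, ¬ {d | 𝒢.graph.abuts d = some u}.Finite :=
    fun u hu hfin => h u hu (hfin.subset fun d hd => hd.1)
  -- the branches of a member into `W` are core branches
  have hsub : ∀ u ∈ W, {b | 𝒢.graph.abuts b = some u ∧ ∃ b', b' ≠ b ∧ 𝒢.graph.edgeOf b' = 𝒢.graph.edgeOf b ∧
      ∃ w' ∈ W, 𝒢.graph.abuts b' = some w'} ⊆ {c | 𝒢.graph.abuts c = some u ∧ ∃ c', c' ≠ c ∧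
      𝒢.graph.edgeOf c' = 𝒢.graph.edgeOf c ∧ ∃ u', 𝒢.graph.abuts c' = some u' ∧ ¬ {d | 𝒢.graph.abuts d = some u'}.Finite} := by
    rintro u hu b ⟨hb, b', hb'b, he, w', hw'W, hb'⟩
    exact ⟨hb, b', hb'b, he, w', hb', hinf w' hw'W⟩
  -- a member and one of its branches into `W`: an edge joining two vertices of infinite core-valence
  obtain ⟨w₀, hw₀⟩ := hW
  obtain ⟨b, hb, b', hb'b, he, w', hw'W, hb'⟩ := Set.Infinite.nonempty (h w₀ hw₀)
  rcases hcs b b' w₀ w' (Ne.symm hb'b) he.symm hb hb' with hfin | hfin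
  · exact h w₀ hw₀ (hfin.subset (hsub w₀ hw₀))
  · exact h w' hw'W (hfin.subset (hsub w' hw'W))

end ProfiniteSemiGraph

end Literature.AnabelianGeometry.SemiGraphs

end
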